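import Summits.ResolutionOfSingularities.ResolutionOfSingularities.Theorems.FrobeniusLadderFInjectiveMacaulayficationNonFullLoopFloorFiveCentre
import Summits.ResolutionOfSingularities.ResolutionOfSingularities.Theorems.FrobeniusLadderFInjectiveMacaulayficationLoopGermMCharts
import HarnessLib

/-!
# (O-3)⁺ THE NON-FULL LOCUS OF THE SECOND LOOP GERM `U_M`, CENTRE SIDE: `𝔮 = (ā, c̄, ē) ⊂ k[a,b,c,d,e]/(M)` is a height-two prime and EVERY point of
# `V(𝔮)` — the PLANE `rad τ(M)` — is NON-FULL (the «⊇» half of «nonFull(U_M) = V(a,c,e)»)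
# (crux `FInjectiveMacaulayfication` stmt-ResolutionOfSingularities-15315, chain w45a; res-L1-w45a-plan-1 g19 RULING R19.18 (iii) context + R19.16 (rad τ(M) = the plane
# `(a,c,e)`, evidence-level) — here its F-side in the kernel; twin of this seat's `…LoopGermLNonFullLine`; pattern = res-L1-w45a-stub-1's ✓ `…NonFullLoopFloorFiveCentre`;
# seat res-L1-w45a-stub-3 g10)

[OURS · L1 W4.5a] Support file (`--supports stmt-ResolutionOfSingularities-15315 --as helper`); replaces the role of NO printed item; NOT a statement of any
manuscript; def-free; UNCONDITIONAL. §1–§3 over ANY field; §4 `CharP k 2`. AI-written (AI review is weaker than expert review).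

`X 0 = a`, `X 1 = b`, `X 2 = c`, `X 3 = d`, `X 4 = e`; `M = X4² + X0²X2X4 + X0X2² + X0²X2X3² + X0X1³X2²` (`…LoopGermMCharts`), `A = k[X]/(M)`, `U_M = Spec A`;
the plane `𝔮 = (ā, c̄, ē) = Ideal.span ((fun j => mk (X j)) '' ↑({0, 2, 4} : Finset (Fin 5)))`.
* §1 `M_mem_span_X_image` (`M ∈ (xⱼ : j ∈ s)` once `0, 4 ∈ s`), `mk_X4_sq` (`ē² = −(ā²c̄ē + āc̄² + ā²c̄d̄² + āb̄³c̄²)`), `not_X_dvd_M`, `mk_X0_ne_zero`;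
* §2 ★ `height_plane : height 𝔮 = 2` — `≤`: minimal over `(ā, c̄)` (`ē² ∈ (ā)`); `≥`: `⊥ < (ā,ē) < 𝔮`;
* §3 ★★ `not_fullCl_atPrime_plane` — `¬ FullCl 2 (A_𝔮)` over ANY field: `dim A_𝔮 = 2`, `(ā, c̄)` is a system of parameters,
  **`ē² = ā²·(−c̄ē − c̄d̄²) + c̄²·(−ā(1+b̄³)) ∈ (ā,c̄)^{[2]}` but `ē ∉ (ā,c̄)A_𝔮`** — witness `A_𝔮 → F[ε]` (`a, c ↦ 0`, `e ↦ ε`, `b, d ↦ b, d`);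
* §4 ★★ `not_fullCl_localization_of_plane_le` / `not_fullCl_stalk_of_plane_le` (`CharP k 2`) — EVERY point `w ⊇ 𝔮` of `U_M` is NON-FULL. The «⊆» half
  (three off-cells `a² · ce`, `c² · a`, `e² · 1`) and the `↔` are the sequel `…LoopGermMNonFullLocus`. So the first centre `V(a,c,e)` of idea-1's 2-round policy
  for `M` (whose `a`-chart is `U_L`, ✓ p645661) IS the non-FULL locus of `U_M`.
[cite: Fedder1983, Prop. 1.7 (context)] [cite: Matsumura1987, Thm. 13.5]
-/

-- single-problem summit: the doubled namespace component is forced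
set_option linter.dupNamespace false

noncomputable section

open AlgebraicGeometry CategoryTheory Literature.AlgebraicGeometry.Resolution TopologicalSpace IsLocalRing MvPolynomial DualNumber

namespace Summit.ResolutionOfSingularities.ResolutionOfSingularities.Theorems.FInjectiveMacaulayfication.LoopGermMNonFullPlane

open Summit.ResolutionOfSingularities.ResolutionOfSingularities.Theorems.FInjectiveMacaulayfication
open SliceableCentre

variable (k : Type) [Field k]

/-! ## §1 Ring facts on `M` -/

/-- `M ∈ (xⱼ : j ∈ s)` as soon as `0, 4 ∈ s` (`M = e·e + a·(ace + c² + acd² + b³c²)`). [folklore] -/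
theorem M_mem_span_X_image (f : MvPolynomial (Fin 5) k) (hf : f = X 4 ^ 2 + X 0 ^ 2 * X 2 * X 4 + X 0 * X 2 ^ 2 + X 0 ^ 2 * X 2 * X 3 ^ 2 + X 0 * X 1 ^ 3 * X 2 ^ 2)
    (s : Set (Fin 5)) (h0 : (0 : Fin 5) ∈ s) (h4 : (4 : Fin 5) ∈ s) : f ∈ Ideal.span (X '' s : Set (MvPolynomial (Fin 5) k)) := by
  have hx : (X 0 : MvPolynomial (Fin 5) k) ∈ Ideal.span (X '' s : Set (MvPolynomial (Fin 5) k)) := Ideal.subset_span ⟨0, h0, rfl⟩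
  have hz : (X 4 : MvPolynomial (Fin 5) k) ∈ Ideal.span (X '' s : Set (MvPolynomial (Fin 5) k)) := Ideal.subset_span ⟨4, h4, rfl⟩
  have hdec : f = X 4 * X 4 + X 0 * (X 0 * X 2 * X 4 + X 2 ^ 2 + X 0 * X 2 * X 3 ^ 2 + X 1 ^ 3 * X 2 ^ 2) := by rw [hf]; ring
  rw [hdec]
  exact Ideal.add_mem _ (Ideal.mul_mem_right _ _ hz) (Ideal.mul_mem_right _ _ hx)

/-- ★ In `A = k[X]/(M)`: `ē² = −(ā²c̄ē + āc̄² + ā²c̄d̄² + āb̄³c̄²)`. [certificate] -/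
theorem mk_X4_sq (f : MvPolynomial (Fin 5) k) (hf : f = X 4 ^ 2 + X 0 ^ 2 * X 2 * X 4 + X 0 * X 2 ^ 2 + X 0 ^ 2 * X 2 * X 3 ^ 2 + X 0 * X 1 ^ 3 * X 2 ^ 2) :
    Ideal.Quotient.mk (Ideal.span {f}) (X 4) ^ 2 =
      -(Ideal.Quotient.mk (Ideal.span {f}) (X 0) ^ 2 * Ideal.Quotient.mk (Ideal.span {f}) (X 2) * Ideal.Quotient.mk (Ideal.span {f}) (X 4) +
        Ideal.Quotient.mk (Ideal.span {f}) (X 0) * Ideal.Quotient.mk (Ideal.span {f}) (X 2) ^ 2 +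
        Ideal.Quotient.mk (Ideal.span {f}) (X 0) ^ 2 * Ideal.Quotient.mk (Ideal.span {f}) (X 2) * Ideal.Quotient.mk (Ideal.span {f}) (X 3) ^ 2 +
        Ideal.Quotient.mk (Ideal.span {f}) (X 0) * Ideal.Quotient.mk (Ideal.span {f}) (X 1) ^ 3 * Ideal.Quotient.mk (Ideal.span {f}) (X 2) ^ 2) := by
  have h0 : Ideal.Quotient.mk (Ideal.span {f}) f = 0 := Ideal.Quotient.eq_zero_iff_mem.mpr (Ideal.subset_span rfl)
  have hid : (X 4 : MvPolynomial (Fin 5) k) ^ 2 = -(X 0 ^ 2 * X 2 * X 4 + X 0 * X 2 ^ 2 + X 0 ^ 2 * X 2 * X 3 ^ 2 + X 0 * X 1 ^ 3 * X 2 ^ 2) + f := by rw [hf]; ring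
  have h1 := congrArg (Ideal.Quotient.mk (Ideal.span {f})) hid
  rw [map_add, h0, add_zero] at h1
  simpa only [map_neg, map_mul, map_pow, map_add] using h1

/-- No variable divides `M` (`M(e_z) = 1`; `M(1,0,1,0,0) = 1`). [certificate] -/
theorem not_X_dvd_M (f : MvPolynomial (Fin 5) k) (hf : f = X 4 ^ 2 + X 0 ^ 2 * X 2 * X 4 + X 0 * X 2 ^ 2 + X 0 ^ 2 * X 2 * X 3 ^ 2 + X 0 * X 1 ^ 3 * X 2 ^ 2) (i : Fin 5) : ¬ ((X i : MvPolynomial (Fin 5) k) ∣ f) := by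
  rintro ⟨c, hc⟩
  by_cases hi : i = 4
  · subst hi
    have := congrArg (MvPolynomial.eval ![(1 : k), 0, 1, 0, 0]) hc
    rw [hf] at this
    simp at this
  · have := congrArg (MvPolynomial.eval (Pi.single 4 1 : Fin 5 → k)) hc
    rw [hf] at this
    simp [hi] at this

/-- `ā ≠ 0` in `A` (`M ∤ a`). [plumbing] -/
theorem mk_X0_ne_zero (f : MvPolynomial (Fin 5) k) (hf : f = X 4 ^ 2 + X 0 ^ 2 * X 2 * X 4 + X 0 * X 2 ^ 2 + X 0 ^ 2 * X 2 * X 3 ^ 2 + X 0 * X 1 ^ 3 * X 2 ^ 2) :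
    Ideal.Quotient.mk (Ideal.span {f}) (X 0) ≠ 0 := fun h0 =>
  PrimeTransfer.X_not_mem_span_of_isPrime (i := 0)
    ((Ideal.span_singleton_prime (LoopGermMCharts.prime_M k f hf).ne_zero).mpr (LoopGermMCharts.prime_M k f hf))
    (fun h => not_X_dvd_M k f hf 0 (Ideal.mem_span_singleton.mp h)) (Ideal.Quotient.eq_zero_iff_mem.mp h0)

/-! ## §2 The height of the plane `𝔮 = (ā, c̄, ē)` -/

/-- ★ **`height 𝔮 = 2`**: `𝔮` is minimal over `(ā, c̄)` (`ē² ∈ (ā)`), so `height 𝔮 ≤ 2` (Krull); and `⊥ < (ā, ē) < 𝔮` are primes of the domain `A`.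
[cite: Matsumura1987, Thm. 13.5] -/
theorem height_plane (f : MvPolynomial (Fin 5) k) (hf : f = X 4 ^ 2 + X 0 ^ 2 * X 2 * X 4 + X 0 * X 2 ^ 2 + X 0 ^ 2 * X 2 * X 3 ^ 2 + X 0 * X 1 ^ 3 * X 2 ^ 2) :
    (Ideal.span ((fun j : Fin 5 => Ideal.Quotient.mk (Ideal.span {f}) (X j)) '' (({0, 2, 4} : Finset (Fin 5)) : Set (Fin 5)))).height = 2 := by
  classical
  haveI := (Ideal.span_singleton_prime (LoopGermMCharts.prime_M k f hf).ne_zero).mpr (LoopGermMCharts.prime_M k f hf)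
  haveI : IsDomain (MvPolynomial (Fin 5) k ⧸ Ideal.span {f}) := Ideal.Quotient.isDomain _
  set mk : MvPolynomial (Fin 5) k →+* MvPolynomial (Fin 5) k ⧸ Ideal.span {f} := Ideal.Quotient.mk (Ideal.span {f}) with hmk
  haveI h𝔮 : (Ideal.span ((fun j : Fin 5 => Ideal.Quotient.mk (Ideal.span {f}) (X j)) '' (({0, 2, 4} : Finset (Fin 5)) : Set (Fin 5)))).IsPrime :=
    NonFullLoopFloorFive.isPrime_span_image_mk k f _ (M_mem_span_X_image k f hf _ (by simp) (by simp))
  haveI h𝔭₁ : (Ideal.span ((fun j : Fin 5 => Ideal.Quotient.mk (Ideal.span {f}) (X j)) '' (({0, 4} : Finset (Fin 5)) : Set (Fin 5)))).IsPrime :=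
    NonFullLoopFloorFive.isPrime_span_image_mk k f _ (M_mem_span_X_image k f hf _ (by simp) (by simp))
  have hz2 := mk_X4_sq k f hf
  apply le_antisymm
  · -- `≤ 2`: minimal over `(ā, c̄)`
    have hmin : Ideal.span ((fun j : Fin 5 => Ideal.Quotient.mk (Ideal.span {f}) (X j)) '' (({0, 2, 4} : Finset (Fin 5)) : Set (Fin 5))) ∈
        (Ideal.span (({mk (X 0), mk (X 2)} : Finset (MvPolynomial (Fin 5) k ⧸ Ideal.span {f})) : Set (MvPolynomial (Fin 5) k ⧸ Ideal.span {f}))).minimalPrimes := by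
      refine ⟨⟨h𝔮, ?_⟩, ?_⟩
      · rw [Finset.coe_insert, Finset.coe_singleton, Ideal.span_le]
        rintro r hr
        rcases hr with rfl | rfl
        · exact Ideal.subset_span ⟨0, by simp, rfl⟩
        · exact Ideal.subset_span ⟨2, by simp, rfl⟩
      · rintro q ⟨hq, hxq⟩ hq𝔮
        rw [Finset.coe_insert, Finset.coe_singleton, Ideal.span_le] at hxq
        have hx : mk (X 0) ∈ q := hxq (Or.inl rfl)
        have hc : mk (X 2) ∈ q := hxq (Or.inr rfl)
        have hz : mk (X 4) ∈ q := by
          apply hq.mem_of_pow_mem 2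
          rw [hz2]
          refine Submodule.neg_mem _ (Ideal.add_mem _ (Ideal.add_mem _ (Ideal.add_mem _ ?_ ?_) ?_) ?_)
          · exact Ideal.mul_mem_right _ _ (Ideal.mul_mem_right _ _ (Ideal.pow_mem_of_mem _ hx 2 two_pos))
          · exact Ideal.mul_mem_right _ _ hx
          · exact Ideal.mul_mem_right _ _ (Ideal.mul_mem_right _ _ (Ideal.pow_mem_of_mem _ hx 2 two_pos))
          · exact Ideal.mul_mem_right _ _ (Ideal.mul_mem_right _ _ hx)
        rw [Ideal.span_le]
        rintro _ ⟨j, hj, rfl⟩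
        simp only [Finset.coe_insert, Finset.coe_singleton, Set.mem_insert_iff, Set.mem_singleton_iff] at hj
        rcases hj with rfl | rfl | rfl
        · exact hx
        · exact hc
        · exact hz
    refine (Ideal.height_le_card_of_mem_minimalPrimes_span_finset hmin).trans ?_
    exact_mod_cast Finset.card_le_two
  · -- `≥ 2`: `⊥ < (ā, ē) < 𝔮`
    have h𝔭0 : Ideal.span ((fun j : Fin 5 => Ideal.Quotient.mk (Ideal.span {f}) (X j)) '' (({0, 4} : Finset (Fin 5)) : Set (Fin 5))) ≠ ⊥ := fun hbot =>
      mk_X0_ne_zero k f hf ((Submodule.eq_bot_iff _).mp hbot _ (Ideal.subset_span ⟨0, by simp, rfl⟩))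
    have h1 : (1 : ℕ∞) ≤ (Ideal.span ((fun j : Fin 5 => Ideal.Quotient.mk (Ideal.span {f}) (X j)) '' (({0, 4} : Finset (Fin 5)) : Set (Fin 5)))).height := by
      rw [Order.one_le_iff_ne_zero, Ne, Ideal.height_eq_zero_iff_eq_bot]
      exact h𝔭0
    have hlt : Ideal.span ((fun j : Fin 5 => Ideal.Quotient.mk (Ideal.span {f}) (X j)) '' (({0, 4} : Finset (Fin 5)) : Set (Fin 5))) < Ideal.span ((fun j : Fin 5 => Ideal.Quotient.mk (Ideal.span {f}) (X j)) '' (({0, 2, 4} : Finset (Fin 5)) : Set (Fin 5))) := by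
      refine lt_of_le_of_ne (Ideal.span_mono (Set.image_mono (by simp))) fun heq => ?_
      have hc : mk (X 2) ∈ Ideal.span ((fun j : Fin 5 => Ideal.Quotient.mk (Ideal.span {f}) (X j)) '' (({0, 2, 4} : Finset (Fin 5)) : Set (Fin 5))) := Ideal.subset_span ⟨2, by simp, rfl⟩
      rw [← heq, NonFullLoopFloorFive.mk_X_mem_span_image_iff k f _ (M_mem_span_X_image k f hf _ (by simp) (by simp))] at hc
      simp at hc
    have h2 := Ideal.height_strict_mono_of_isPrime_of_isPrime hlt
    have hne : (Ideal.span ((fun j : Fin 5 => Ideal.Quotient.mk (Ideal.span {f}) (X j)) '' (({0, 4} : Finset (Fin 5)) : Set (Fin 5)))).height ≠ ⊤ := Ideal.height_ne_top Ideal.IsPrime.ne_top'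
    calc (2 : ℕ∞) = 1 + 1 := by norm_num
      _ ≤ (Ideal.span ((fun j : Fin 5 => Ideal.Quotient.mk (Ideal.span {f}) (X j)) '' (({0, 4} : Finset (Fin 5)) : Set (Fin 5)))).height + 1 := add_le_add h1 le_rfl
      _ ≤ _ := (ENat.add_one_le_iff hne).mpr h2

/-! ## §3 ★★ The local ring at the plane is two-dimensional and NOT FULL (any field) -/

set_option maxHeartbeats 800000 in
-- one localization lift into `Frac(k[X])[ε]` + several ideal-membership computations (same budget as `NonFullLoopFloorFiveCentre.not_fullCl_atPrime_centre`)
/-- ★★ **`¬ FullCl 2 (A_𝔮)` AT THE GENERIC POINT `𝔮 = (ā, c̄, ē)` OF THE PLANE** (ANY field `k`): `dim A_𝔮 = 2`; `(ā, c̄)` is a system of parameters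
(`ē² ∈ (ā)`); `ē² = ā²·(−c̄ē − c̄d̄²) + c̄²·(−ā(1 + b̄³)) ∈ (ā, c̄)^{[2]}`; but `ē ∉ (ā, c̄)A_𝔮` — the map `A_𝔮 → F[ε]`, `F = Frac k[X]`, `a, c ↦ 0`, `e ↦ ε`,
`b, d ↦ b, d` kills `M` and `(ā, c̄)` and sends `ē` to `ε ≠ 0` (elements off `𝔮` go to units). So the Frobenius-closure clause of `FullCl 2` fails for the
parameter ideal `(ā, c̄)`. [OURS · certificate; cite: Fedder1983, Prop. 1.7 (context)] -/
theorem not_fullCl_atPrime_plane (f : MvPolynomial (Fin 5) k) (hf : f = X 4 ^ 2 + X 0 ^ 2 * X 2 * X 4 + X 0 * X 2 ^ 2 + X 0 ^ 2 * X 2 * X 3 ^ 2 + X 0 * X 1 ^ 3 * X 2 ^ 2)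
    (Q : Ideal (MvPolynomial (Fin 5) k ⧸ Ideal.span {f})) [Q.IsPrime]
    (hQ : Q = Ideal.span ((fun j : Fin 5 => Ideal.Quotient.mk (Ideal.span {f}) (X j)) '' (({0, 2, 4} : Finset (Fin 5)) : Set (Fin 5)))) :
    ¬ FullCl 2 (Localization.AtPrime Q) := by
  intro hfull
  set R := MvPolynomial (Fin 5) k ⧸ Ideal.span {f} with hR
  set mk : MvPolynomial (Fin 5) k →+* R := Ideal.Quotient.mk (Ideal.span {f}) with hmk
  set Lo := Localization.AtPrime Q with hLo
  set alg : R →+* Lo := algebraMap R Lo with halg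
  -- (1) the dimension
  have hdim : ringKrullDim Lo = (2 : ℕ) := by
    rw [IsLocalization.AtPrime.ringKrullDim_eq_height Q Lo, hQ, height_plane k f hf]
    rfl
  -- (2) the system of parameters `(ā, c̄)`
  set s : Fin 2 → Lo := ![alg (mk (X 0)), alg (mk (X 2))] with hs
  have hx0 : alg (mk (X 0)) ∈ Ideal.span (Set.range s) := Ideal.subset_span ⟨0, rfl⟩
  have hx2 : alg (mk (X 2)) ∈ Ideal.span (Set.range s) := Ideal.subset_span ⟨1, rfl⟩
  have hz2 : alg (mk (X 4)) ^ 2 = alg (mk (X 0)) ^ 2 * (-(alg (mk (X 2)) * alg (mk (X 4)) + alg (mk (X 2)) * alg (mk (X 3)) ^ 2)) +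
      alg (mk (X 2)) ^ 2 * (-(alg (mk (X 0)) * (1 + alg (mk (X 1)) ^ 3))) := by
    have h := congrArg alg (mk_X4_sq k f hf)
    simp only [map_pow, map_neg, map_mul, map_add] at h
    rw [h]; ring
  have hz2mem : alg (mk (X 4)) ^ 2 ∈ Ideal.span (Set.range s) := by
    rw [hz2]
    exact Ideal.add_mem _ (Ideal.mul_mem_right _ _ (Ideal.pow_mem_of_mem _ hx0 2 two_pos))
      (Ideal.mul_mem_right _ _ (Ideal.pow_mem_of_mem _ hx2 2 two_pos))
  have hmaxL : IsLocalRing.maximalIdeal Lo = Q.map alg := (Localization.AtPrime.map_eq_maximalIdeal (I := Q)).symm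
  have hle : Ideal.span (Set.range s) ≤ IsLocalRing.maximalIdeal Lo := by
    rw [Ideal.span_le]
    rintro _ ⟨j, rfl⟩
    rw [hmaxL]
    fin_cases j
    · exact Ideal.mem_map_of_mem _ (by rw [hQ]; exact Ideal.subset_span ⟨0, by simp, rfl⟩)
    · exact Ideal.mem_map_of_mem _ (by rw [hQ]; exact Ideal.subset_span ⟨2, by simp, rfl⟩)
  have hrad_eq : (Ideal.span (Set.range s)).radical = IsLocalRing.maximalIdeal Lo := by
    apply le_antisymm
    · exact (Ideal.radical_mono hle).trans_eq (IsLocalRing.maximalIdeal.isMaximal Lo).isPrime.radical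
    · rw [hmaxL]
      refine Ideal.map_le_iff_le_comap.mpr fun q hq => ?_
      rw [hQ] at hq
      refine (Ideal.span_le.mpr ?_) hq
      rintro _ ⟨j, hj, rfl⟩
      simp only [Finset.coe_insert, Finset.coe_singleton, Set.mem_insert_iff, Set.mem_singleton_iff] at hj
      rw [SetLike.mem_coe, Ideal.mem_comap]
      rcases hj with rfl | rfl | rfl
      · exact Ideal.le_radical hx0
      · exact Ideal.le_radical hx2
      · exact ⟨2, hz2mem⟩
  have hrad : (Ideal.span (Set.range s)).radical.IsMaximal := by
    rw [hrad_eq]; exact IsLocalRing.maximalIdeal.isMaximal Lo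
  -- (3) the Frobenius-closure clause of `FullCl 2` at `y = ē`, `e = 1`
  obtain ⟨-, hclause⟩ := hfull
  have hF3 := (hclause 2 hdim s hrad).2 (alg (mk (X 4))) ⟨1, by
    rw [pow_one, hz2]
    exact Ideal.add_mem _ (Ideal.mul_mem_right _ _ (Ideal.subset_span ⟨alg (mk (X 0)), hx0, rfl⟩))
      (Ideal.mul_mem_right _ _ (Ideal.subset_span ⟨alg (mk (X 2)), hx2, rfl⟩))⟩
  -- (4) `ē ∉ (ā, c̄) A_𝔮`: evaluate into the dual numbers over `F = Frac k[X]`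
  let Fr := FractionRing (MvPolynomial (Fin 5) k)
  let ι : MvPolynomial (Fin 5) k →+* Fr := algebraMap _ _
  let φk : k →+* Fr[ε] := (TrivSqZeroExt.inlHom Fr Fr).comp (ι.comp MvPolynomial.C)
  let v : Fin 5 → Fr[ε] := fun j => if j = 4 then ε else if j = 0 ∨ j = 2 then 0 else TrivSqZeroExt.inl (ι (X j))
  have hv4 : v 4 = ε := by simp [v]
  have hv0 : v 0 = 0 := by simp [v]
  have hv2 : v 2 = 0 := by simp [v]
  have hε2 : (ε : Fr[ε]) ^ 2 = 0 := by rw [pow_two, DualNumber.eps_mul_eps]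
  have hφg : eval₂Hom φk v f = 0 := by
    rw [hf]
    simp only [map_add, map_mul, map_pow, eval₂Hom_X', hv4, hv0, hv2, hε2, zero_pow two_ne_zero, zero_mul, mul_zero, add_zero]
  let φ₁ : R →+* Fr[ε] := Ideal.Quotient.lift (Ideal.span {f}) (eval₂Hom φk v) fun a ha => by
    obtain ⟨c, rfl⟩ := Ideal.mem_span_singleton'.mp ha
    rw [map_mul, hφg, mul_zero]
  have hφ₁ : ∀ q : MvPolynomial (Fin 5) k, φ₁ (mk q) = eval₂Hom φk v q := fun q => Ideal.Quotient.lift_mk _ _ _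
  -- the first component of `eval₂Hom φk v` is `ι ∘ (a, c, e ↦ 0)`
  have hfst : ∀ q : MvPolynomial (Fin 5) k, TrivSqZeroExt.fst (eval₂Hom φk v q) =
      ι (aeval (fun i : Fin 5 => if i ∈ ((({0, 2, 4} : Finset (Fin 5)) : Set (Fin 5))) then (0 : MvPolynomial (Fin 5) k) else X i) q) := by
    intro q
    have hcomp : (TrivSqZeroExt.fstHom Fr Fr Fr).toRingHom.comp (eval₂Hom φk v) =
        ι.comp (aeval (fun i : Fin 5 => if i ∈ ((({0, 2, 4} : Finset (Fin 5)) : Set (Fin 5))) then (0 : MvPolynomial (Fin 5) k) else X i)).toRingHom := by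
      refine MvPolynomial.ringHom_ext (fun a => ?_) (fun j => ?_)
      · simp [φk, TrivSqZeroExt.inlHom]
      · fin_cases j <;> simp [v]
    have h1 := RingHom.congr_fun hcomp q
    change TrivSqZeroExt.fst (eval₂Hom φk v q) = ι (aeval _ q) at h1
    exact h1
  have hunit : ∀ y : Q.primeCompl, IsUnit (φ₁ y) := by
    rintro ⟨y, hy'⟩
    obtain ⟨q, rfl⟩ := Ideal.Quotient.mk_surjective y
    change IsUnit (φ₁ (mk q))
    rw [hφ₁, TrivSqZeroExt.isUnit_iff_isUnit_fst, hfst, isUnit_iff_ne_zero]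
    intro hc
    apply hy'
    have hc' : aeval (fun i : Fin 5 => if i ∈ ((({0, 2, 4} : Finset (Fin 5)) : Set (Fin 5))) then (0 : MvPolynomial (Fin 5) k) else X i) q = 0 :=
      (IsFractionRing.injective (MvPolynomial (Fin 5) k) Fr) (by rw [map_zero]; exact hc)
    have hq : q ∈ Ideal.span (X '' ((({0, 2, 4} : Finset (Fin 5)) : Set (Fin 5))) : Set (MvPolynomial (Fin 5) k)) := by
      rw [← Literature.RingTheory.MvPolynomial.ker_aeval_ite_eq_span]; exact hc'
    have := Ideal.mem_map_of_mem mk hq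
    rw [← NonFullLoopFloorFive.span_image_mk_eq_map] at this
    change mk q ∈ Q
    rw [hQ]; exact this
  let ψ : Lo →+* Fr[ε] := IsLocalization.lift (M := Q.primeCompl) (g := φ₁) hunit
  have hψ : ∀ r : R, ψ (alg r) = φ₁ r := fun r => IsLocalization.lift_eq (M := Q.primeCompl) hunit r
  -- `ψ` kills `(s) = (ā, c̄)` …
  have hψs : ∀ w ∈ Ideal.span (Set.range s), ψ w = 0 := by
    intro w hw
    have hmap : Ideal.span (Set.range s) ≤ RingHom.ker ψ := by
      rw [Ideal.span_le]
      rintro _ ⟨j, rfl⟩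
      rw [SetLike.mem_coe, RingHom.mem_ker, hs]
      fin_cases j
      · change ψ (alg (mk (X 0))) = 0
        rw [hψ, hφ₁, eval₂Hom_X', hv0]
      · change ψ (alg (mk (X 2))) = 0
        rw [hψ, hφ₁, eval₂Hom_X', hv2]
    exact hmap hw
  -- … but not `ē ↦ ε`
  have hε : ψ (alg (mk (X 4))) = ε := by
    rw [hψ, hφ₁, eval₂Hom_X', hv4]
  have h0 := hψs _ hF3
  rw [hε] at h0
  have := congrArg TrivSqZeroExt.snd h0
  rw [DualNumber.snd_eps, TrivSqZeroExt.snd_zero] at this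
  exact one_ne_zero this

/-! ## §4 ★★ Every point of the plane `V(ā, c̄, ē) ⊂ U_M` is NON-FULL -/

/-- ★★ **`¬ FullCl 2 (A_P)` for EVERY prime `P ⊇ 𝔮 = (ā, c̄, ē)`** (`char k = 2`): FULL at `P` would localize to FULL at `𝔮 ⊆ P`
(`ClauseOfMaximal.fiClause_atPrime_of_le`), contradicting §3. [OURS · certificate] -/
theorem not_fullCl_localization_of_plane_le [CharP k 2] (f : MvPolynomial (Fin 5) k) (hf : f = X 4 ^ 2 + X 0 ^ 2 * X 2 * X 4 + X 0 * X 2 ^ 2 + X 0 ^ 2 * X 2 * X 3 ^ 2 + X 0 * X 1 ^ 3 * X 2 ^ 2)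
    (P : Ideal (MvPolynomial (Fin 5) k ⧸ Ideal.span {f})) [P.IsPrime]
    (hP : Ideal.span ((fun j : Fin 5 => Ideal.Quotient.mk (Ideal.span {f}) (X j)) '' (({0, 2, 4} : Finset (Fin 5)) : Set (Fin 5))) ≤ P) :
    ¬ FullCl 2 (Localization.AtPrime P) := by
  haveI : Fact (Nat.Prime 2) := ⟨Nat.prime_two⟩
  haveI := (Ideal.span_singleton_prime (LoopGermMCharts.prime_M k f hf).ne_zero).mpr (LoopGermMCharts.prime_M k f hf)
  haveI : IsDomain (MvPolynomial (Fin 5) k ⧸ Ideal.span {f}) := Ideal.Quotient.isDomain _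
  haveI : CharP (MvPolynomial (Fin 5) k ⧸ Ideal.span {f}) 2 := charP_of_injective_algebraMap (algebraMap k _).injective 2
  haveI : (Ideal.span ((fun j : Fin 5 => Ideal.Quotient.mk (Ideal.span {f}) (X j)) '' (({0, 2, 4} : Finset (Fin 5)) : Set (Fin 5)))).IsPrime :=
    NonFullLoopFloorFive.isPrime_span_image_mk k f _ (M_mem_span_X_image k f hf _ (by simp) (by simp))
  intro hfull
  exact not_fullCl_atPrime_plane k f hf _ rfl (ClauseOfMaximal.fiClause_atPrime_of_le 2 hP hfull)

/-- ★★ **THE «⊇» HALF OF «nonFull(U_M) = V(a,c,e)»** (stalk form): every point `w` of `U_M = Spec k[X]/(M)` with `(ā, c̄, ē) ≤ w` is NON-FULL (`char k = 2`).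
[OURS · certificate] -/
theorem not_fullCl_stalk_of_plane_le [CharP k 2] (f : MvPolynomial (Fin 5) k) (hf : f = X 4 ^ 2 + X 0 ^ 2 * X 2 * X 4 + X 0 * X 2 ^ 2 + X 0 ^ 2 * X 2 * X 3 ^ 2 + X 0 * X 1 ^ 3 * X 2 ^ 2)
    (w : Spec (.of (MvPolynomial (Fin 5) k ⧸ Ideal.span {f})))
    (hw : Ideal.span ((fun j : Fin 5 => Ideal.Quotient.mk (Ideal.span {f}) (X j)) '' (({0, 2, 4} : Finset (Fin 5)) : Set (Fin 5))) ≤ w.asIdeal) :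
    ¬ FullCl 2 ((Spec (.of (MvPolynomial (Fin 5) k ⧸ Ideal.span {f}))).presheaf.stalk w) := fun hfull =>
  not_fullCl_localization_of_plane_le k f hf w.asIdeal hw
    (WFixAtNonClosedDimTwo.fullCl_of_ringEquiv 2 (Spec.stalkIso (.of _) w).commRingCatIsoToRingEquiv hfull)

end Summit.ResolutionOfSingularities.ResolutionOfSingularities.Theorems.FInjectiveMacaulayfication.LoopGermMNonFullPlane

end
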